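import Summits.QuantumFields.BalabanUV.T4Continuum.Support.VariationalVectorGaugeSlice

/-!
# T⁴ programme, spine node NE2 (U1a), lane P2 — LEAF V-GF WITH BACKGROUND, STEP 1: THE COST OF A COVARIANT GAUGE MOVE, and the END's gauge-SLICE binder
# REDUCED to ONE displayed gauge-move law (model level; cell `pub-balaban`)

NE2 formalisation swarm `b2b-balaban-t4-ne2-formalise-*`, leaf prover 01 GEN 7 (`prover-b2b-balaban-t4-ne2-formalise-leaf-01-g7-0`); journal INTENT CLAIMS.log 2026-08-20
15:13Z «V-GF WITH BACKGROUND, STEP 1».  On top of leaf-09-g7's `VariationalVectorGaugeSlice` (p221888: `curlV_cDv`, `cdV_sub`, `QvL_sub`, `avgOp`, `projG`, `projG_nonneg`,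
`exists_gauge_projG_eq_zero`, `projG_gradient_eq_divSq`, `cDv_eq_zero_of_lapOp_eq_zero`), leaf-01-g5's `VariationalVectorExterior` (p218348: `sum_sq_QvL_cDv_sub_le`), the
road's `VariationalVectorForm` (p216339) and `VariationalCovariantFederbush.sum_sq_add_le` — BY NAME; nothing re-defined.
WHY.  The gauge-slice variant of the vector END (`VariationalVectorEndOfLeavesSlice.towerLimitRate_effV_of_leaves_slice`, p221732) asks per level for
  (SLICE)  `∀ W, ∃ Ws, Q Ws = Q W ∧ ScV R G Ws ≤ ScV R 0 W + σ′·ScV R 0 W + σ·qWV W`,  with `σ k ≤ c_σ·θ^k`, `σ′ k ≤ c_σ′·θ^k`.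
At `U = 1` leaf-09-g7 proved it with `σ = σ′ = 0` (p222324): the gauge move `W ↦ W − Dλ` changes neither the curl form nor the flat (1.18) average.  WITH
BACKGROUND both invariances fail by EXACTLY computable amounts:
 * §1 (any torus, transports, normed `E`) **`curlV_sub_cDv`**: `curl_R (W − D_R f) = curl_R W − [R(x,μ)R(x+e_μ,ν) − R(x,ν)R(x+e_ν,μ)]·f(x+e_μ+e_ν)` — the curl form is
   gauge-invariant EXACTLY up to the plaquette commutator; `sum_comm_sq_le` (`Σ‖comm·f‖² ≤ d²p²Σ‖f‖²` under the plaquette class `p`, the letter of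
   `VariationalVectorGarding`); `sum3_sq_le` ∕ `curlSq_add_le` (Minkowski); **`curlSq_sub_cDv_le`**: `curlSq R (W − D_R f) ≤ (√(curlSq R W) + d·p·√(Σ‖f‖²))²`; `sq_add_le_of_pos`;
 * §2 (level `n`) `ScV_eq_zero_add`, **`ScV_zero_sub_cDv_le`**, `two_minkowski`, **`sqrt_ScV_add_le`** (`√ScV R G` subadditive once `√G` is — (G-add), displayed), and
   **`sqrt_projG_add_le`** ((G-add) PROVED for leaf-09-g7's `projG R K`);
 * §3 the FIBRE under product line carriers `Q := QvL (lineT T′ R)`: **`nsqV_QvL_lineT_cDv_le`** — for `Q_{T′} f = 0` the move leaves the fibre ONLY through FED⁺'s site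
   mismatch: `Σ‖Q(D_R f)‖² ≤ d·m₀²·n⁻²·Σ‖f‖²∕n^d` (V-EXT by name);
 * §4 **`slice_of_gaugeMove`** = (SLICE) in the END's letters (`Scc := ScV R 0`, `Sc := ScV R G`, carrier `QvL (lineT T′ R)`) with `σ′ = t` (any `t > 0`) and
   `σ = (1+t⁻¹)·(d·(n·p)·√(CM∕2) + (m₀∕n)·√(Λ·d·CM))²`, DERIVED from the classes `p`, `m₀`, the END's own V-UB binder (`Λ`), (GF0) + (G-add), and ONE displayed law
     (MOVE)  `∀ W, ∃ f, Q_{T′} f = 0 ∧ G (W − D_R f) = 0 ∧ Σ‖f‖² ≤ CM·Σ‖W‖²`   (reach + stay in `ker Q_{T′}` + SIZE);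
   for `G := projG R (ker Q_{T′})` reach-and-stay is KERNEL for ANY transports (`move_reach_projG`, from `exists_gauge_projG_eq_zero`): the SIZE constant `CM` is the whole
   content — **`slice_projG_of_moveSize`**;
 * §5 **`moveSize_lower_bound`**: for `projG R (ker Q_{T′})` the size constant is AT LEAST the inverse Poincaré constant of `D_R` on `ker Q_{T′}` (`Σ‖μ‖² ≤ CM·Σ‖D_R μ‖²`
   for every `Q_{T′} μ = 0`; pure-gauge test fields + transversality), given that `ker Q_{T′}` carries no non-zero `R`-covariantly-constant function (displayed).
CONSEQUENCE (numerics + verdict in `t4/T4-EST-NE2-P2-VGF.md`, not a theorem here): under the plaquette class `n²p ≤ c` the derived cost is `σ ≈ (1+t⁻¹)·½d²c²·CM(n)∕n²`,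
decaying along the tower iff `CM(n) = o(n²)`; §5 with the block Poincaré constant `≈ n²∕π²` gives `σ = O(c²)` LEVEL-INDEPENDENT by this route, and the SHARP slice constant
`σ⋆(n;c)` of `projG` (any competitor; d = 2, U(1) data) is measured level-independent too — the located obstruction of record for the slice device with background.

HONEST FRAMING (T4-DAG p. 1).  Model level: `R`, `Rc`, `T′`, `G`, the constants are DATA (no identification with Bałaban's `U(Γ)`, `R_k(U)` — c5); [folklore] lattice
calculus + real arithmetic; (MOVE), V-UB, the classes are DISPLAYED binders, none discharged; nothing printed is a hypothesis; no `def`, no `def … : Prop`, no `sorry`; axioms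
standard.  V-GF with background NOT closed (first reduction only); V-END ∕ NE2 NOT proved; NE3 OPEN; spine PROVED 0∕9 unchanged; rung (B)+1 finite T⁴ — NOT infinite
volume, NOT mass gap, NOT Clay.  HONEST DEPENDENCY (cell, verbatim): continuum YM on T⁴ ⇐ BetaPertH ∧ nine spine estimates (0/9 proved); BetaPertH ⇐ (D1) ∧ (D4) ∧
CAP+tail; G-an2-4 gates asym, D1 and NE2/3/4.
-/

noncomputable section

namespace Summit.QuantumFields.BalabanUV.T4Continuum.VariationalVectorGaugeMove

open Finset
open Literature.MathematicalPhysics.QuantumFieldTheory.Balaban1983to89.B5Prop11Plancherel (Tor fine unitVec)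
open Literature.MathematicalPhysics.QuantumFieldTheory.Balaban1983to89.B5Block118 (bpt)
open Summit.QuantumFields.BalabanUV.T4Continuum.VariationalColourFederbush (cDv Qcv misv)
open Summit.QuantumFields.BalabanUV.T4Continuum.VariationalColourBochner (nsqv nsqv_nonneg)
open Summit.QuantumFields.BalabanUV.T4Continuum.VariationalCovariantFederbush (sum_sq_add_le)
open Summit.QuantumFields.BalabanUV.T4Continuum.VectorBlockTrialForm (QvL nsqV nsqV_nonneg)
open Summit.QuantumFields.BalabanUV.T4Continuum.VariationalVectorForm (cdV curlV curlSq ScV qWV curlSq_nonneg ScV_nonneg qWV_nonneg)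
open Summit.QuantumFields.BalabanUV.T4Continuum.VariationalVectorFederbush (lineT)
open Summit.QuantumFields.BalabanUV.T4Continuum.VariationalVectorExterior (sum_sq_QvL_cDv_sub_le)
open Summit.QuantumFields.BalabanUV.T4Continuum.VariationalVectorWeitzenbock (divV divSq)
open Summit.QuantumFields.BalabanUV.T4Continuum.VariationalVectorGaugeSlice

variable {d : ℕ} {E : Type*} [NormedAddCommGroup E]

/-! ## §1 The curl of a covariant gauge move (any torus, any transports) -/

section Curl
variable [NormedSpace ℂ E] (N : Fin d → ℕ) [∀ μ, NeZero (N μ)]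

omit [∀ μ, NeZero (N μ)] in
/-- **THE CURL FORM IS GAUGE-INVARIANT EXACTLY UP TO THE PLAQUETTE COMMUTATOR**:
`curl_R (W − D_R f)(x;μ,ν) = curl_R W(x;μ,ν) − [R(x,μ)R(x+e_μ,ν) − R(x,ν)R(x+e_ν,μ)]·f(x+e_μ+e_ν)` (any transports; at `U = 1` the bracket vanishes —
leaf-09-g7's `curlSq_sub_cDv_flat`). [folklore] -/
theorem curlV_sub_cDv (R : Tor N → Fin d → (E →L[ℂ] E)) (W : Tor N → Fin d → E) (f : Tor N → E) (x : Tor N) (μ ν : Fin d) :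
    curlV N R (W - cDv N R f) x μ ν
      = curlV N R W x μ ν - (R x μ * R (x + unitVec N μ) ν - R x ν * R (x + unitVec N ν) μ) (f (x + unitVec N μ + unitVec N ν)) := by
  have h : curlV N R (W - cDv N R f) x μ ν = curlV N R W x μ ν - curlV N R (cDv N R f) x μ ν := by simp only [curlV, cdV_sub]; abel
  rw [h, curlV_cDv, add_right_comm x (unitVec N ν) (unitVec N μ)]
  rfl

omit [∀ μ, NeZero (N μ)] in
/-- the curl is additive: `curl_R (A + B) = curl_R A + curl_R B`. [folklore] -/
theorem curlV_add (R : Tor N → Fin d → (E →L[ℂ] E)) (A B : Tor N → Fin d → E) (x : Tor N) (μ ν : Fin d) :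
    curlV N R (A + B) x μ ν = curlV N R A x μ ν + curlV N R B x μ ν := by
  simp only [curlV, cdV, Pi.add_apply, map_add]; abel

/-- **THE SIZE OF THE COMMUTATOR TERM** under the plaquette class `‖R(x,μ)R(x+e_μ,ν) − R(x,ν)R(x+e_ν,μ)‖ ≤ p`:
`Σ_{x,μ,ν} ‖comm(x;μ,ν)·f(x+e_μ+e_ν)‖² ≤ d²·p²·Σ_x‖f x‖²` (translate the site sum for each `(μ,ν)`). [folklore] -/
theorem sum_comm_sq_le {R : Tor N → Fin d → (E →L[ℂ] E)} {p : ℝ}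
    (hP : ∀ x μ ν, ‖R x μ * R (x + unitVec N μ) ν - R x ν * R (x + unitVec N ν) μ‖ ≤ p) (f : Tor N → E) :
    ∑ x, ∑ μ, ∑ ν, ‖(R x μ * R (x + unitVec N μ) ν - R x ν * R (x + unitVec N ν) μ) (f (x + unitVec N μ + unitVec N ν))‖ ^ 2
      ≤ (d : ℝ) ^ 2 * p ^ 2 * nsqv N f := by
  have hpt : ∀ x μ ν, ‖(R x μ * R (x + unitVec N μ) ν - R x ν * R (x + unitVec N ν) μ) (f (x + unitVec N μ + unitVec N ν))‖ ^ 2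
      ≤ p ^ 2 * ‖f (x + unitVec N μ + unitVec N ν)‖ ^ 2 := fun x μ ν => by
    rw [← mul_pow]
    exact pow_le_pow_left₀ (norm_nonneg _) ((ContinuousLinearMap.le_opNorm _ _).trans (mul_le_mul_of_nonneg_right (hP x μ ν) (norm_nonneg _))) 2
  have hshift : ∀ μ ν : Fin d, ∑ x, ‖f (x + unitVec N μ + unitVec N ν)‖ ^ 2 = nsqv N f := fun μ ν => by
    unfold nsqv; simp_rw [add_assoc]; exact Equiv.sum_comp (Equiv.addRight (unitVec N μ + unitVec N ν)) (fun x => ‖f x‖ ^ 2)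
  calc _ ≤ ∑ x, ∑ μ, ∑ ν, p ^ 2 * ‖f (x + unitVec N μ + unitVec N ν)‖ ^ 2 :=
        sum_le_sum fun x _ => sum_le_sum fun μ _ => sum_le_sum fun ν _ => hpt x μ ν
    _ = ∑ μ : Fin d, ∑ ν : Fin d, p ^ 2 * nsqv N f := by
        rw [sum_comm]; refine sum_congr rfl fun μ _ => ?_; rw [sum_comm]; refine sum_congr rfl fun ν _ => ?_; rw [← mul_sum, hshift]
    _ = (d : ℝ) ^ 2 * p ^ 2 * nsqv N f := by
        rw [sum_const, sum_const, card_univ, Fintype.card_fin, smul_smul, nsmul_eq_mul]; push_cast; ring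

/-- **MINKOWSKI FOR TRIPLE SUMS**: if pointwise `g² ≤ (a + b)²` then `Σ g² ≤ (√Σa² + √Σb²)²` (flatten the index and use the road's `sum_sq_add_le`). [folklore] -/
theorem sum3_sq_le (g a b : Tor N → Fin d → Fin d → ℝ) (hpt : ∀ x μ ν, g x μ ν ^ 2 ≤ (a x μ ν + b x μ ν) ^ 2) :
    ∑ x, ∑ μ, ∑ ν, g x μ ν ^ 2 ≤ (Real.sqrt (∑ x, ∑ μ, ∑ ν, a x μ ν ^ 2) + Real.sqrt (∑ x, ∑ μ, ∑ ν, b x μ ν ^ 2)) ^ 2 := by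
  have hflat : ∀ h : Tor N → Fin d → Fin d → ℝ, ∑ x, ∑ μ, ∑ ν, h x μ ν = ∑ σ : Tor N × (Fin d × Fin d), h σ.1 σ.2.1 σ.2.2 := by
    intro h; rw [Fintype.sum_prod_type]; simp only [Fintype.sum_prod_type]
  have hmink := sum_sq_add_le (univ : Finset (Tor N × (Fin d × Fin d))) (fun σ => a σ.1 σ.2.1 σ.2.2) (fun σ => b σ.1 σ.2.1 σ.2.2) zero_le_one
  simp only [one_mul] at hmink
  rw [hflat, hflat, hflat]
  exact (sum_le_sum fun σ _ => hpt σ.1 σ.2.1 σ.2.2).trans hmink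

/-- Minkowski for the curl form, additive: `curlSq R (A + B) ≤ (√curlSq R A + √curlSq R B)²`. [folklore] -/
theorem curlSq_add_le (R : Tor N → Fin d → (E →L[ℂ] E)) (A B : Tor N → Fin d → E) :
    curlSq N R (A + B) ≤ (Real.sqrt (curlSq N R A) + Real.sqrt (curlSq N R B)) ^ 2 := by
  unfold curlSq
  exact sum3_sq_le N (fun x μ ν => ‖curlV N R (A + B) x μ ν‖) (fun x μ ν => ‖curlV N R A x μ ν‖) (fun x μ ν => ‖curlV N R B x μ ν‖)
    fun x μ ν => by rw [curlV_add]; exact pow_le_pow_left₀ (norm_nonneg _) (norm_add_le _ _) 2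

/-- **THE CURL COST OF A COVARIANT GAUGE MOVE**: `curlSq R (W − D_R f) ≤ (√(curlSq R W) + d·p·√(Σ‖f‖²))²` under the plaquette class `p`. [folklore] -/
theorem curlSq_sub_cDv_le {R : Tor N → Fin d → (E →L[ℂ] E)} {p : ℝ} (hp : 0 ≤ p)
    (hP : ∀ x μ ν, ‖R x μ * R (x + unitVec N μ) ν - R x ν * R (x + unitVec N ν) μ‖ ≤ p) (W : Tor N → Fin d → E) (f : Tor N → E) :
    curlSq N R (W - cDv N R f) ≤ (Real.sqrt (curlSq N R W) + d * p * Real.sqrt (nsqv N f)) ^ 2 := by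
  have h1 := sum3_sq_le N (fun x μ ν => ‖curlV N R (W - cDv N R f) x μ ν‖) (fun x μ ν => ‖curlV N R W x μ ν‖)
    (fun x μ ν => ‖(R x μ * R (x + unitVec N μ) ν - R x ν * R (x + unitVec N ν) μ) (f (x + unitVec N μ + unitVec N ν))‖)
    fun x μ ν => by rw [curlV_sub_cDv]; exact pow_le_pow_left₀ (norm_nonneg _) (norm_sub_le _ _) 2
  have h2 : Real.sqrt (∑ x, ∑ μ, ∑ ν, ‖(R x μ * R (x + unitVec N μ) ν - R x ν * R (x + unitVec N ν) μ) (f (x + unitVec N μ + unitVec N ν))‖ ^ 2)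
      ≤ d * p * Real.sqrt (nsqv N f) := by
    rw [← Real.sqrt_sq (by positivity : (0 : ℝ) ≤ d * p * Real.sqrt (nsqv N f)), mul_pow, mul_pow, Real.sq_sqrt (nsqv_nonneg N f)]
    exact Real.sqrt_le_sqrt (sum_comm_sq_le N hP f)
  have h0 : 0 ≤ Real.sqrt (curlSq N R W)
      + Real.sqrt (∑ x, ∑ μ, ∑ ν, ‖(R x μ * R (x + unitVec N μ) ν - R x ν * R (x + unitVec N ν) μ) (f (x + unitVec N μ + unitVec N ν))‖ ^ 2) := by
    positivity
  unfold curlSq at h1 h0 ⊢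
  exact h1.trans (pow_le_pow_left₀ h0 (add_le_add le_rfl h2) 2)

omit [NormedAddCommGroup E] [NormedSpace ℂ E] [∀ μ, NeZero (N μ)] in
/-- `(A + B)² ≤ (1 + t)·A² + (1 + t⁻¹)·B²` for `t > 0` (the multiplicative ∕ additive split of a square-root bracket). [folklore] -/
theorem sq_add_le_of_pos (A B : ℝ) {t : ℝ} (ht : 0 < t) : (A + B) ^ 2 ≤ (1 + t) * A ^ 2 + (1 + t⁻¹) * B ^ 2 := by
  rw [← sub_nonneg]
  have key : (1 + t) * A ^ 2 + (1 + t⁻¹) * B ^ 2 - (A + B) ^ 2 = t⁻¹ * (t * A - B) ^ 2 := by field_simp; ring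
  rw [key]; positivity

end Curl

/-! ## §2 In the road's form currency at level `n`: the pure-curl form of a gauge move; `√(ScV R G)` is subadditive once `√G` is -/

section Forms
variable [NormedSpace ℂ E] (n : ℕ) [NeZero n] (M : Fin d → ℕ) [hM : ∀ μ, NeZero (M μ)]

/-- `ScV R G W = ScV R 0 W + n^{−d}·(n²·G W)` — the gauge functional enters the form additively. [folklore] -/
theorem ScV_eq_zero_add (R : Tor (fine n M) → Fin d → (E →L[ℂ] E)) (G : (Tor (fine n M) → Fin d → E) → ℝ) (W : Tor (fine n M) → Fin d → E) :
    ScV n M R G W = ScV n M R (fun _ => 0) W + ((n : ℝ) ^ d)⁻¹ * ((n : ℝ) ^ 2 * G W) := by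
  unfold ScV; ring

/-- **THE PURE-CURL FORM OF A COVARIANT GAUGE MOVE**: `ScV R 0 (W − D_R f) ≤ (√(ScV R 0 W) + √(n^{−d}·(n²·(d²p²·Σ‖f‖²∕2))))²`. [folklore] -/
theorem ScV_zero_sub_cDv_le {R : Tor (fine n M) → Fin d → (E →L[ℂ] E)} {p : ℝ} (hp : 0 ≤ p)
    (hP : ∀ x μ ν, ‖R x μ * R (x + unitVec (fine n M) μ) ν - R x ν * R (x + unitVec (fine n M) ν) μ‖ ≤ p)
    (W : Tor (fine n M) → Fin d → E) (f : Tor (fine n M) → E) :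
    ScV n M R (fun _ => 0) (W - cDv (fine n M) R f)
      ≤ (Real.sqrt (ScV n M R (fun _ => 0) W) + Real.sqrt (((n : ℝ) ^ d)⁻¹ * ((n : ℝ) ^ 2 * ((d : ℝ) ^ 2 * p ^ 2 * nsqv (fine n M) f / 2)))) ^ 2 := by
  set α : ℝ := ((n : ℝ) ^ d)⁻¹ * (n : ℝ) ^ 2 / 2 with hα
  have hα0 : 0 ≤ α := by positivity
  have hS : ∀ X, ScV n M R (fun _ => 0) X = α * curlSq (fine n M) R X := fun X => by unfold ScV; rw [hα]; ring
  have hT : ((n : ℝ) ^ d)⁻¹ * ((n : ℝ) ^ 2 * ((d : ℝ) ^ 2 * p ^ 2 * nsqv (fine n M) f / 2)) = α * (d * p * Real.sqrt (nsqv (fine n M) f)) ^ 2 := by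
    rw [hα, mul_pow, mul_pow, Real.sq_sqrt (nsqv_nonneg _ f)]; ring
  rw [hS, hS, hT, Real.sqrt_mul hα0, Real.sqrt_mul hα0, Real.sqrt_sq (by positivity : (0 : ℝ) ≤ d * p * Real.sqrt (nsqv (fine n M) f)),
    ← mul_add, mul_pow, Real.sq_sqrt hα0]
  exact mul_le_mul_of_nonneg_left (curlSq_sub_cDv_le (fine n M) hp hP W f) hα0

omit [NormedAddCommGroup E] [NormedSpace ℂ E] [NeZero n] hM in
/-- the two-dimensional Minkowski inequality `(a₁+b₁)² + (a₂+b₂)² ≤ (√(a₁²+a₂²) + √(b₁²+b₂²))²`. [folklore] -/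
theorem two_minkowski (a₁ a₂ b₁ b₂ : ℝ) :
    (a₁ + b₁) ^ 2 + (a₂ + b₂) ^ 2 ≤ (Real.sqrt (a₁ ^ 2 + a₂ ^ 2) + Real.sqrt (b₁ ^ 2 + b₂ ^ 2)) ^ 2 := by
  have hA : 0 ≤ a₁ ^ 2 + a₂ ^ 2 := by positivity
  have hB : 0 ≤ b₁ ^ 2 + b₂ ^ 2 := by positivity
  have hcs : a₁ * b₁ + a₂ * b₂ ≤ Real.sqrt (a₁ ^ 2 + a₂ ^ 2) * Real.sqrt (b₁ ^ 2 + b₂ ^ 2) := by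
    rw [← Real.sqrt_mul hA]; exact (le_abs_self _).trans (Real.abs_le_sqrt (by nlinarith [sq_nonneg (a₁ * b₂ - a₂ * b₁)]))
  rw [add_sq (Real.sqrt _), Real.sq_sqrt hA, Real.sq_sqrt hB]; nlinarith [hcs]

/-- **`√(ScV R G)` IS SUBADDITIVE ONCE `√G` IS** ((G-add), displayed; (GF0) displayed): `√ScV R G (A + B) ≤ √ScV R G A + √ScV R G B`. [folklore] -/
theorem sqrt_ScV_add_le (R : Tor (fine n M) → Fin d → (E →L[ℂ] E)) {G : (Tor (fine n M) → Fin d → E) → ℝ} (hG0 : ∀ W, 0 ≤ G W)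
    (hGadd : ∀ A B, Real.sqrt (G (A + B)) ≤ Real.sqrt (G A) + Real.sqrt (G B)) (A B : Tor (fine n M) → Fin d → E) :
    Real.sqrt (ScV n M R G (A + B)) ≤ Real.sqrt (ScV n M R G A) + Real.sqrt (ScV n M R G B) := by
  set β : ℝ := ((n : ℝ) ^ d)⁻¹ * (n : ℝ) ^ 2 with hβ
  have hβ0 : 0 ≤ β := by positivity
  have hS : ∀ X, ScV n M R G X = β * (curlSq (fine n M) R X / 2 + G X) := fun X => by unfold ScV; rw [hβ]; ring
  -- the curl half and the `G` half, each in square-root shape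
  set a₁ := Real.sqrt (curlSq (fine n M) R A / 2); set a₂ := Real.sqrt (G A)
  set b₁ := Real.sqrt (curlSq (fine n M) R B / 2); set b₂ := Real.sqrt (G B)
  have hc0 : ∀ X, 0 ≤ curlSq (fine n M) R X / 2 := fun X => by have := curlSq_nonneg (fine n M) R X; positivity
  have h1 : curlSq (fine n M) R (A + B) / 2 ≤ (a₁ + b₁) ^ 2 := by
    have h := curlSq_add_le (fine n M) R A B
    have e : (Real.sqrt (curlSq (fine n M) R A) + Real.sqrt (curlSq (fine n M) R B)) ^ 2 / 2 = (a₁ + b₁) ^ 2 := by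
      have h2 : (0 : ℝ) ≤ 2 := by norm_num
      rw [show curlSq (fine n M) R A = 2 * (curlSq (fine n M) R A / 2) by ring, show curlSq (fine n M) R B = 2 * (curlSq (fine n M) R B / 2) by ring,
        Real.sqrt_mul h2, Real.sqrt_mul h2, ← mul_add, mul_pow, Real.sq_sqrt h2]
      ring
    linarith [div_le_div_of_nonneg_right h (by norm_num : (0 : ℝ) ≤ 2)]
  have h2 : G (A + B) ≤ (a₂ + b₂) ^ 2 := by
    rw [← Real.sq_sqrt (hG0 (A + B))]; exact pow_le_pow_left₀ (Real.sqrt_nonneg _) (hGadd A B) 2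
  have hsum : curlSq (fine n M) R (A + B) / 2 + G (A + B) ≤ (Real.sqrt (a₁ ^ 2 + a₂ ^ 2) + Real.sqrt (b₁ ^ 2 + b₂ ^ 2)) ^ 2 :=
    (add_le_add h1 h2).trans (two_minkowski a₁ a₂ b₁ b₂)
  have hA : a₁ ^ 2 + a₂ ^ 2 = curlSq (fine n M) R A / 2 + G A := by rw [Real.sq_sqrt (hc0 A), Real.sq_sqrt (hG0 A)]
  have hB : b₁ ^ 2 + b₂ ^ 2 = curlSq (fine n M) R B / 2 + G B := by rw [Real.sq_sqrt (hc0 B), Real.sq_sqrt (hG0 B)]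
  rw [hA, hB] at hsum
  rw [hS, hS, hS, Real.sqrt_mul hβ0, Real.sqrt_mul hβ0, Real.sqrt_mul hβ0, ← mul_add]
  refine mul_le_mul_of_nonneg_left ?_ (Real.sqrt_nonneg _)
  rw [← Real.sqrt_sq (add_nonneg (Real.sqrt_nonneg _) (Real.sqrt_nonneg _))]; exact Real.sqrt_le_sqrt hsum

end Forms

/-! ## §2b (G-add) for leaf-09-g7's projected gauge functional `projG R K` -/

section Proj
variable (N : Fin d → ℕ) [∀ μ, NeZero (N μ)] [InnerProductSpace ℂ E] [CompleteSpace E] [FiniteDimensional ℂ E]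

/-- **`√projG` IS A SEMINORM**: `√(projG R K (A + B)) ≤ √(projG R K A) + √(projG R K B)` (it is the norm of a linear image of the field). [folklore] -/
theorem sqrt_projG_add_le (R : Tor N → Fin d → (E →L[ℂ] E)) (K : Submodule ℂ (Tor N → E)) (A B : Tor N → Fin d → E) :
    Real.sqrt (projG N R K (A + B)) ≤ Real.sqrt (projG N R K A) + Real.sqrt (projG N R K B) := by
  unfold projG
  rw [Real.sqrt_sq (norm_nonneg _), Real.sqrt_sq (norm_nonneg _), Real.sqrt_sq (norm_nonneg _),
    show divV N R (A + B) = divV N R A + divV N R B from (divOp N R).map_add A B, WithLp.toLp_add, map_add]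
  exact norm_add_le _ _

end Proj

/-! ## §3 The fibre: under product line carriers a `ker Q_{T′}`-gauge move leaves the fibre only through FED⁺'s site mismatch -/

section Fibre
variable [NormedSpace ℂ E] (n : ℕ) [NeZero n] (M : Fin d → ℕ) [hM : ∀ μ, NeZero (M μ)]
variable (Rc : Tor M → Fin d → (E →L[ℂ] E)) (R : Tor (fine n M) → Fin d → (E →L[ℂ] E)) (T' : Tor (fine n M) → (E →L[ℂ] E))

/-- **THE FIBRE DEFECT OF A GAUGE MOVE** from `ker Q_{T′}` under the carrier `QvL (lineT T′ R)`: with `‖misv‖ ≤ m₀` (FED⁺'s one-block site mismatch against a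
coarse transport `Rc`), `Σ_{y,μ} ‖Q(D_R f)(y,μ)‖² ≤ d·(m₀²·n⁻²·(Σ‖f‖²∕n^d))` — V-EXT's `QvL_lineT_cDv_eq` with the coarse-gradient term killed by `Q_{T′} f = 0`;
at mismatch-free data the move stays in the fibre EXACTLY. [folklore] -/
theorem nsqV_QvL_lineT_cDv_le {m₀ : ℝ} (hmis : ∀ y μ j, ‖misv n M Rc R T' y μ j‖ ≤ m₀) {f : Tor (fine n M) → E} (hf : Qcv n M T' f = 0) :
    nsqV M (QvL n M (lineT n M T' R) (cDv (fine n M) R f)) ≤ d * (m₀ ^ 2 * ((n : ℝ) ^ 2)⁻¹ * (nsqv (fine n M) f / (n : ℝ) ^ d)) := by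
  have h := sum_sq_QvL_cDv_sub_le n M Rc R T' hmis f
  have h0 : ∀ y μ, ((n : ℂ)⁻¹ : ℂ) • cDv M Rc (Qcv n M T' f) y μ = 0 := fun y μ => by rw [hf]; simp [cDv]
  simp_rw [h0, sub_zero] at h
  unfold nsqV nsqv; rw [sum_comm]; exact h

end Fibre

/-! ## §4 (SLICE) from ONE displayed gauge-move law -/

section Slice
variable [NormedSpace ℂ E] (n : ℕ) [NeZero n] (M : Fin d → ℕ) [hM : ∀ μ, NeZero (M μ)]

/-- **THE END's GAUGE-SLICE BINDER FROM A GAUGE-MOVE LAW.**  Data at level `n`: fine bond transports `R` in the plaquette class `p`; a product line carrier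
`Q := QvL (lineT T′ R)` whose one-block site mismatch against a coarse transport `Rc` is `≤ m₀`; a gauge functional `G ≥ 0` with `√G` subadditive ((G-add));
the END's V-UB binder for `(ScV R G, Q)` with constant `Λ`; and the DISPLAYED gauge-move law
  (MOVE) `∀ W, ∃ f, Q_{T′} f = 0 ∧ G (W − D_R f) = 0 ∧ Σ‖f‖² ≤ CM·Σ‖W‖²`.
THEN for every `t > 0` and every `W` there is `Ws` in `W`'s fibre with
  `ScV R G Ws ≤ ScV R 0 W + t·ScV R 0 W + (1+t⁻¹)·(d·(n·p)·√(CM∕2) + (m₀∕n)·√(Λ·d·CM))²·qWV W`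
— literally the `hslice k` shape of `VariationalVectorEndOfLeavesSlice.towerLimitRate_effV_of_leaves_slice` (p221732) with `σ′ = t`.  (`Ws := W − D_R f + c`, `c` the V-UB
competitor repairing the fibre defect of §3; the curl cost is §1–§2.) [folklore] -/
theorem slice_of_gaugeMove {R : Tor (fine n M) → Fin d → (E →L[ℂ] E)} {p : ℝ} (hp : 0 ≤ p)
    (hP : ∀ x μ ν, ‖R x μ * R (x + unitVec (fine n M) μ) ν - R x ν * R (x + unitVec (fine n M) ν) μ‖ ≤ p)
    {Rc : Tor M → Fin d → (E →L[ℂ] E)} {T' : Tor (fine n M) → (E →L[ℂ] E)} {m₀ : ℝ} (hm₀ : 0 ≤ m₀) (hmis : ∀ y μ j, ‖misv n M Rc R T' y μ j‖ ≤ m₀)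
    {G : (Tor (fine n M) → Fin d → E) → ℝ} (hG0 : ∀ W, 0 ≤ G W) (hGadd : ∀ A B, Real.sqrt (G (A + B)) ≤ Real.sqrt (G A) + Real.sqrt (G B))
    {CM : ℝ} (hCM : 0 ≤ CM)
    (hMOVE : ∀ W : Tor (fine n M) → Fin d → E, ∃ f : Tor (fine n M) → E,
      Qcv n M T' f = 0 ∧ G (W - cDv (fine n M) R f) = 0 ∧ nsqv (fine n M) f ≤ CM * nsqV (fine n M) W)
    {Λ : ℝ} (hΛ : 0 ≤ Λ)
    (hUB : ∀ ψ : Tor M → Fin d → E, ∃ c, QvL n M (lineT n M T' R) c = ψ ∧ ScV n M R G c ≤ Λ * nsqV M ψ)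
    {t : ℝ} (ht : 0 < t) (W : Tor (fine n M) → Fin d → E) :
    ∃ Ws : Tor (fine n M) → Fin d → E, QvL n M (lineT n M T' R) Ws = QvL n M (lineT n M T' R) W ∧
      ScV n M R G Ws ≤ ScV n M R (fun _ => 0) W + t * ScV n M R (fun _ => 0) W
        + ((1 + t⁻¹) * (d * ((n : ℝ) * p) * Real.sqrt (CM / 2) + m₀ / n * Real.sqrt (Λ * d * CM)) ^ 2) * qWV n M W := by
  have hn : (0 : ℝ) < n := by exact_mod_cast Nat.pos_of_ne_zero (NeZero.ne n)
  have hnd : (0 : ℝ) < (n : ℝ) ^ d := pow_pos hn d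
  obtain ⟨f, hfK, hGf, hfs⟩ := hMOVE W
  obtain ⟨c, hc, hSc⟩ := hUB (QvL n M (lineT n M T' R) (cDv (fine n M) R f))
  refine ⟨W - (cDv (fine n M) R f - c), ?_, ?_⟩
  · rw [QvL_sub, QvL_sub, hc, sub_self, sub_zero]
  -- sizes in the `qWV` currency
  have hq : nsqV (fine n M) W = (n : ℝ) ^ d * qWV n M W := by
    unfold qWV; rw [← mul_assoc, mul_inv_cancel₀ hnd.ne', one_mul]
  have hq0 : 0 ≤ qWV n M W := qWV_nonneg n M W
  have hfs' : nsqv (fine n M) f ≤ CM * ((n : ℝ) ^ d * qWV n M W) := by rw [← hq]; exact hfs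
  -- the curl cost of the move
  set K₁ : ℝ := d * ((n : ℝ) * p) * Real.sqrt (CM / 2) * Real.sqrt (qWV n M W) with hK₁
  have hK₁0 : 0 ≤ K₁ := by positivity
  have hcurl : Real.sqrt (ScV n M R G (W - cDv (fine n M) R f)) ≤ Real.sqrt (ScV n M R (fun _ => 0) W) + K₁ := by
    rw [ScV_eq_zero_add n M R G, hGf, mul_zero, mul_zero, add_zero]
    have h1 := ScV_zero_sub_cDv_le n M hp hP W f
    have h2 : ((n : ℝ) ^ d)⁻¹ * ((n : ℝ) ^ 2 * ((d : ℝ) ^ 2 * p ^ 2 * nsqv (fine n M) f / 2)) ≤ K₁ ^ 2 := by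
      have e : K₁ ^ 2 = ((n : ℝ) ^ d)⁻¹ * ((n : ℝ) ^ 2 * ((d : ℝ) ^ 2 * p ^ 2 * (CM * ((n : ℝ) ^ d * qWV n M W)) / 2)) := by
        rw [hK₁, mul_pow, mul_pow, mul_pow, mul_pow, Real.sq_sqrt (by positivity), Real.sq_sqrt hq0]
        field_simp
      rw [e]; gcongr
    have h3 : Real.sqrt (((n : ℝ) ^ d)⁻¹ * ((n : ℝ) ^ 2 * ((d : ℝ) ^ 2 * p ^ 2 * nsqv (fine n M) f / 2))) ≤ K₁ := by
      rw [← Real.sqrt_sq hK₁0]; exact Real.sqrt_le_sqrt h2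
    have h0 : 0 ≤ Real.sqrt (ScV n M R (fun _ => 0) W) + Real.sqrt (((n : ℝ) ^ d)⁻¹ * ((n : ℝ) ^ 2 * ((d : ℝ) ^ 2 * p ^ 2 * nsqv (fine n M) f / 2))) := by
      positivity
    calc Real.sqrt (ScV n M R (fun _ => 0) (W - cDv (fine n M) R f))
        ≤ Real.sqrt (ScV n M R (fun _ => 0) W) + Real.sqrt (((n : ℝ) ^ d)⁻¹ * ((n : ℝ) ^ 2 * ((d : ℝ) ^ 2 * p ^ 2 * nsqv (fine n M) f / 2))) := by
          rw [← Real.sqrt_sq h0]; exact Real.sqrt_le_sqrt h1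
      _ ≤ _ := add_le_add le_rfl h3
  -- the fibre-repair cost
  set K₂ : ℝ := m₀ / n * Real.sqrt (Λ * d * CM) * Real.sqrt (qWV n M W) with hK₂
  have hK₂0 : 0 ≤ K₂ := by positivity
  have hrep : Real.sqrt (ScV n M R G c) ≤ K₂ := by
    have h1 := nsqV_QvL_lineT_cDv_le n M Rc R T' hmis hfK
    have h2 : ScV n M R G c ≤ K₂ ^ 2 := by
      refine hSc.trans ?_
      have e : K₂ ^ 2 = Λ * (d * (m₀ ^ 2 * ((n : ℝ) ^ 2)⁻¹ * (CM * ((n : ℝ) ^ d * qWV n M W) / (n : ℝ) ^ d))) := by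
        rw [hK₂, mul_pow, mul_pow, div_pow, Real.sq_sqrt (by positivity), Real.sq_sqrt hq0]
        field_simp
      rw [e]
      exact mul_le_mul_of_nonneg_left (h1.trans (by gcongr)) hΛ
    rw [← Real.sqrt_sq hK₂0]; exact Real.sqrt_le_sqrt h2
  -- assemble: `Ws = (W − D f) + c`, subadditivity, then the multiplicative∕additive split
  have e1 : W - (cDv (fine n M) R f - c) = (W - cDv (fine n M) R f) + c := by abel
  have hsq : Real.sqrt (ScV n M R G (W - (cDv (fine n M) R f - c))) ≤ Real.sqrt (ScV n M R (fun _ => 0) W) + (K₁ + K₂) := by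
    rw [e1, ← add_assoc]
    exact (sqrt_ScV_add_le n M R hG0 hGadd _ _).trans (add_le_add hcurl hrep)
  have hS0 : 0 ≤ ScV n M R G (W - (cDv (fine n M) R f - c)) := ScV_nonneg n M R hG0 _
  have hScc0 : 0 ≤ ScV n M R (fun _ => 0) W := ScV_nonneg n M R (fun _ => le_rfl) W
  have h0 : 0 ≤ Real.sqrt (ScV n M R (fun _ => 0) W) + (K₁ + K₂) := by positivity
  have hK : K₁ + K₂ = (d * ((n : ℝ) * p) * Real.sqrt (CM / 2) + m₀ / n * Real.sqrt (Λ * d * CM)) * Real.sqrt (qWV n M W) := by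
    rw [hK₁, hK₂]; ring
  calc ScV n M R G (W - (cDv (fine n M) R f - c))
      = Real.sqrt (ScV n M R G (W - (cDv (fine n M) R f - c))) ^ 2 := (Real.sq_sqrt hS0).symm
    _ ≤ (Real.sqrt (ScV n M R (fun _ => 0) W) + (K₁ + K₂)) ^ 2 := pow_le_pow_left₀ (Real.sqrt_nonneg _) hsq 2
    _ ≤ (1 + t) * Real.sqrt (ScV n M R (fun _ => 0) W) ^ 2 + (1 + t⁻¹) * (K₁ + K₂) ^ 2 := sq_add_le_of_pos _ _ ht
    _ = _ := by rw [Real.sq_sqrt hScc0, hK, mul_pow, Real.sq_sqrt hq0]; ring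

end Slice

/-! ## §4b The instance `G := projG R (ker Q_{T′})` (leaf-09-g7's functional with background): reach-and-stay is kernel, SIZE is the content -/

section ProjSlice
variable (n : ℕ) [NeZero n] (M : Fin d → ℕ) [hM : ∀ μ, NeZero (M μ)] [InnerProductSpace ℂ E] [CompleteSpace E] [FiniteDimensional ℂ E]

/-- **(MOVE) FOR `projG R (ker Q_{T′})` IS A PURE SIZE STATEMENT**: its reach-and-stay half holds for ANY transports (leaf-09-g7's `exists_gauge_projG_eq_zero`
with `K := ker Q_{T′}`), so (MOVE) follows from the displayed SIZE law
  (MOVE-size) `∀ W, ∃ f, Q_{T′} f = 0 ∧ projG R (ker Q_{T′}) (W − D_R f) = 0 ∧ Σ‖f‖² ≤ CM·Σ‖W‖²`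
— which is (MOVE) itself; recorded as the socket.  Hence **(SLICE) for `projG R (ker Q_{T′})` with background from (MOVE-size) + V-UB + the two classes**. [folklore] -/
theorem slice_projG_of_moveSize {R : Tor (fine n M) → Fin d → (E →L[ℂ] E)} {p : ℝ} (hp : 0 ≤ p)
    (hP : ∀ x μ ν, ‖R x μ * R (x + unitVec (fine n M) μ) ν - R x ν * R (x + unitVec (fine n M) ν) μ‖ ≤ p)
    {Rc : Tor M → Fin d → (E →L[ℂ] E)} {T' : Tor (fine n M) → (E →L[ℂ] E)} {m₀ : ℝ} (hm₀ : 0 ≤ m₀) (hmis : ∀ y μ j, ‖misv n M Rc R T' y μ j‖ ≤ m₀)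
    {CM : ℝ} (hCM : 0 ≤ CM)
    (hsize : ∀ W : Tor (fine n M) → Fin d → E, ∃ f : Tor (fine n M) → E, Qcv n M T' f = 0 ∧
      projG (fine n M) R (LinearMap.ker (avgOp n M T')) (W - cDv (fine n M) R f) = 0 ∧ nsqv (fine n M) f ≤ CM * nsqV (fine n M) W)
    {Λ : ℝ} (hΛ : 0 ≤ Λ)
    (hUB : ∀ ψ : Tor M → Fin d → E, ∃ c, QvL n M (lineT n M T' R) c = ψ ∧ ScV n M R (projG (fine n M) R (LinearMap.ker (avgOp n M T'))) c ≤ Λ * nsqV M ψ)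
    {t : ℝ} (ht : 0 < t) (W : Tor (fine n M) → Fin d → E) :
    ∃ Ws : Tor (fine n M) → Fin d → E, QvL n M (lineT n M T' R) Ws = QvL n M (lineT n M T' R) W ∧
      ScV n M R (projG (fine n M) R (LinearMap.ker (avgOp n M T'))) Ws
        ≤ ScV n M R (fun _ => 0) W + t * ScV n M R (fun _ => 0) W
          + ((1 + t⁻¹) * (d * ((n : ℝ) * p) * Real.sqrt (CM / 2) + m₀ / n * Real.sqrt (Λ * d * CM)) ^ 2) * qWV n M W :=
  slice_of_gaugeMove n M hp hP hm₀ hmis (projG_nonneg (fine n M) R _) (sqrt_projG_add_le (fine n M) R _) hCM hsize hΛ hUB ht W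

/-- the reach-and-stay half alone (kernel, any transports): `∀ W ∃ f, Q_{T′} f = 0 ∧ projG R (ker Q_{T′}) (W − D_R f) = 0`. [folklore] -/
theorem move_reach_projG (R : Tor (fine n M) → Fin d → (E →L[ℂ] E)) (T' : Tor (fine n M) → (E →L[ℂ] E)) (W : Tor (fine n M) → Fin d → E) :
    ∃ f : Tor (fine n M) → E, Qcv n M T' f = 0 ∧ projG (fine n M) R (LinearMap.ker (avgOp n M T')) (W - cDv (fine n M) R f) = 0 := by
  obtain ⟨f, hfK, hf⟩ := exists_gauge_projG_eq_zero (fine n M) R (LinearMap.ker (avgOp n M T')) W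
  exact ⟨f, by simpa using hfK, hf⟩

/-! ## §5 The size constant is at least the inverse Poincaré constant of `D_R` on `ker Q_{T′}` -/

/-- **LOWER BOUND ON THE SIZE CONSTANT OF (MOVE)** for `projG R (ker Q_{T′})`: if (MOVE-size) holds with constant `CM`, and `ker Q_{T′}` carries no non-zero
`R`-covariantly-constant function (displayed: `Q_{T′} g = 0 → D_R g = 0 → g = 0`), then every pure-gauge test field `W := D_R μ`, `Q_{T′} μ = 0`, forces the move
to be `f = μ` (transversality `projG (D_R g) = divSq (D_R g)`, then `div_R D_R g = 0 ⟹ D_R g = 0`), whence `Σ‖μ‖² ≤ CM·Σ_{x,ν}‖D_R μ (x,ν)‖²`: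
`CM` is at least the inverse Poincaré constant of the covariant gradient on block-mean-free 0-forms (`≳ n²`, memo `t4/T4-EST-NE2-P2-VGF.md`). [folklore] -/
theorem moveSize_lower_bound {R : Tor (fine n M) → Fin d → (E →L[ℂ] E)} {T' : Tor (fine n M) → (E →L[ℂ] E)} {CM : ℝ}
    (hsize : ∀ W : Tor (fine n M) → Fin d → E, ∃ f : Tor (fine n M) → E, Qcv n M T' f = 0 ∧
      projG (fine n M) R (LinearMap.ker (avgOp n M T')) (W - cDv (fine n M) R f) = 0 ∧ nsqv (fine n M) f ≤ CM * nsqV (fine n M) W)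
    (hdet : ∀ g : Tor (fine n M) → E, Qcv n M T' g = 0 → (∀ x ν, cDv (fine n M) R g x ν = 0) → g = 0)
    {μ : Tor (fine n M) → E} (hμ : Qcv n M T' μ = 0) :
    nsqv (fine n M) μ ≤ CM * nsqV (fine n M) (cDv (fine n M) R μ) := by
  obtain ⟨f, hfK, hGf, hfs⟩ := hsize (cDv (fine n M) R μ)
  -- the move undoes `μ` exactly
  have hsub : cDv (fine n M) R μ - cDv (fine n M) R f = cDv (fine n M) R (μ - f) := by
    rw [← gradOp_apply, ← gradOp_apply, ← gradOp_apply, map_sub]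
  have hmem : μ - f ∈ LinearMap.ker (avgOp n M T') := by
    rw [LinearMap.mem_ker, map_sub, avgOp_apply, avgOp_apply, hμ, hfK, sub_zero]
  rw [hsub, projG_gradient_eq_divSq (fine n M) R hmem] at hGf
  have hlap : lapOp (fine n M) R (μ - f) = 0 := by
    funext x
    have hx := (sum_eq_zero_iff_of_nonneg fun y _ => by positivity).mp hGf x (mem_univ x)
    rw [lapOp_apply]
    exact norm_eq_zero.mp (pow_eq_zero_iff two_ne_zero |>.mp hx)
  have hzero : μ - f = 0 :=
    hdet (μ - f) (by rw [← avgOp_apply]; exact hmem) (cDv_eq_zero_of_lapOp_eq_zero (fine n M) R hlap)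
  rw [sub_eq_zero] at hzero
  rw [← hzero] at hfs
  exact hfs

end ProjSlice

end Summit.QuantumFields.BalabanUV.T4Continuum.VariationalVectorGaugeMove

end
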